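import Summits.Langlands.Langlands.Theses.HeptagonalTower
import Literature.NumberTheory.Automorphic.ThorneQInfinityModular
import Literature.NumberTheory.Automorphic.X0FifteenOddDegreePoints

/-!
# Birth skeleton (BC3) for crux stmt-Langlands-16987
`Summit.Langlands.Langlands.Theses.HeptagonalTower.OddDegreeDoor` — line `birth`

Route `route-Langlands-HeptagonalTower` (crux #3, rank 3).  The crux: for every totally real number
field `K` embedding in some `ℚ(ζ_{7^{n+1}})`, if every `K`-point of `X₀(15)` (Legendre model
`y² = x(x+16)(x+25)`, inlined as the base change of `⟨0, 41, 0, 400, 0⟩ : WeierstrassCurve ℚ`) is torsion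
and every torsion affine `K`-point is one of the seven listed rational ones, then every elliptic curve
over `K` (integral model, `Δ ≠ 0`) is modular in the summit's inlined Caraiani–Newton sense.

Registered by `planner-skel-stmt-Langlands-16987-0` (skeleton registrar, 2026-08-17).  The cut is the one
the grounders pinned on the item (notes g74-1 / g74-3): `OddDegreeDoor = Thorne2019 Lemma 3 (2) ∘
(subfields of ℚ(ζ_{7^{n+1}})⁺ are cyclic over ℚ, of odd degree, and miss √5) ∘ (Yoshikawa 2022
Cor. 3.3 (1): odd degree slaves X(s3,b5) to X₀(15)) ∘ (the Legendre bridge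
`Thorne2019.variableChange_E₁`, at the level of points)`.  FOUR named stubs, each a genuine lemma of
the line stated over existing declarations, and the kernel-checked composition `OddDegreeDoor_of`
(hypotheses = the four stub statements BY NAME (`_Goal.stub_…`), conclusion = the crux BY NAME, proof =
sorry-free logic):

* `stub_towerField` — **Galois theory of the real 7-cyclotomic tower** (M; Mathlib-provable now): a
  totally real number field `K` with a ring embedding into some `ℚ(ζ_{7^{n+1}})` is Galois and CYCLIC
  over `ℚ` (a subextension of the cyclic extension `ℚ(ζ_{7^{n+1}})/ℚ`, Galois group `(ℤ/7^{n+1})ˣ`),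
  has ODD degree (it sits in the maximal real subfield, of degree `3·7ⁿ`), hence contains no `√5`
  (no quadratic subfield).  These are exactly the side hypotheses of Thorne's Lemma 3 and of
  Yoshikawa's corollary.
* `stub_legendreTransport` — **Legendre-model point control ⇒ `E₁(K) = E₁(ℚ)`** (M; Mathlib-provable
  now): the crux's two hypotheses (every `K`-point of the Legendre model torsion; every torsion affine
  point among the seven listed) imply `Thorne2019.PointsRational Thorne2019.E₁ K` for Thorne's model
  `E₁ = [1,1,1,−10,−10]` (15A1) — transport of affine points along the PROVED `ℚ`-isomorphism
  `legendreChange • E₁ = X0FifteenLegendre` (`x_L = 4x − 12`, `y_L = 8y + 4x + 4`; nonsingularity is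
  automatic on an elliptic curve), then the list gives rational coordinates.
* `stub_oddDegreeDescent` — **Yoshikawa 2022, Cor. 3.3 (1) at `F = ℚ`** (M): for `[K:ℚ]` odd,
  `E₁(K) = E₁(ℚ) ⇒ E₂(K) = E₂(ℚ)` for `E₂ = [1,1,1,−5,2] ≅ X(s3,b5)` (15A3): the degree-2 isogeny
  `E₂ → E₁` over `ℚ` sends a `K`-point to a rational point, whose preimages are at most quadratic, and
  `K` has no quadratic subfield.  Dischargeable from the named fact
  `Literature.NumberTheory.Automorphic.Yoshikawa2022_corollary3_3_1` (`Nonsingular` phrasing;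
  `Equation ↔ Nonsingular` on the elliptic curves `E₁`, `E₂`) or directly by the explicit 2-isogeny (Vélu).
* `stub_thorneLemma3` — **Thorne 2019, Lemma 3 (second part) with Prop. 4** (the load-bearing input;
  XL from scratch = Thorne 2016 Thm 7.6 at 5 + Langlands–Tunnell/FLHS at 3 + moduli of
  `X₀(15)`, `X(s3,b5)` + modularity over `ℚ` + cyclic base change [Lan80]; verbatim the body of the
  named fact `Literature.NumberTheory.Automorphic.Thorne2019_lemma3`, so at proof time it is discharged
  by `(h : Thorne2019_lemma3)`): `K` totally real, `√5 ∉ K`, `K/ℚ` cyclic, `E₁(K) = E₁(ℚ)`,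
  `E₂(K) = E₂(ℚ)` ⇒ every `E/K` with `Δ ≠ 0` is modular (`IsModularEllipticCurve K E`, which unfolds
  symbol-for-symbol to the crux's inlined disjunction).

None of the four is the crux or the summit in costume: stubs 1–3 say nothing about modularity;
stub 4 needs the cyclicity / `√5` / odd-degree facts (stub 1), the Legendre transport (stub 2) and the
`X(s3,b5)` control (stub 3) before it touches the crux's hypotheses, and it concludes modularity of
elliptic curves over ONE class of fields, not `Langlands` (reciprocity for all `GL_n` over all number
fields).  BC3 probes `stub → OddDegreeDoor` / `stub → Langlands` by
`first | exact? | simpa | aesop` (and the `simpa [C] | (unfold C; simpa)` variants) fail for all four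
(planner folder `bc/probe_*.lean`, NOTES.md `birth-certificate:`).

Disproof used: none — no `Disproof.lean` / `Negative/` exists on this crux at registration time
(`ledger crux ls stmt-Langlands-16987`: no workfiles).  Dead lines: none recorded.  Barriers: the route's
catalogued barriers (`ResiduallyReducibleBarrier(Narrow)`, `PatchingLocalComponentBarrier(Narrow)`) live
entirely inside stub 4's cited lifting theorems, exactly as the route header says; stubs 1–3 are
barrier-free arithmetic of one pair of curves over `ℚ`.

Leans on (by name): `Summit.Langlands.Langlands.Theses.HeptagonalTower.OddDegreeDoor` (the crux),
`Literature.NumberTheory.Automorphic.Thorne2019.PointsRational / E₁ / E₂ / legendreChange /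
variableChange_E₁` (proved bridge), `Literature.NumberTheory.Automorphic.IsModularEllipticCurve`,
`…Thorne2019_lemma3` (named fact, unproved), `…Yoshikawa2022_corollary3_3_1` (named fact, unproved),
Mathlib `NumberField.IsTotallyReal`, `CyclotomicField`, `IsGalois`, `IsCyclic`, `Module.finrank`,
`IsSquare`, `WeierstrassCurve.baseChange`, `WeierstrassCurve.Affine.Point`, `IsOfFinAddOrder`.

Shape (for `ledger skeleton check`): stubs `theorem stub_<name> : <signature> := by sorry`;
`_Goal.stub_<name> : Prop := type_of% @stub_<name>` names each statement; the composition
`OddDegreeDoor_of (h₁ : _Goal.stub_towerField) … (h₄ : _Goal.stub_thorneLemma3) : OddDegreeDoor` is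
proved without `sorry`; the same composition with the four signatures spelled out is repeated as an
`example`.
-/

noncomputable section

-- `Summit.Langlands.Langlands.…`: summit = sub-problem name (D-0017 nested layout), not a typo.
set_option linter.dupNamespace false
set_option linter.unusedVariables false

namespace Summit.Langlands.Langlands.Cruxes.OddDegreeDoor.Birth

-- the route file's `open`s, verbatim (so that the crux's hypotheses and the stubs elaborate to the same
-- terms — in particular `DecidableEq K` on affine points comes from `Classical`, as in the route file)
open scoped BigOperators Topology Manifold Classical MeasureTheory ProbabilityTheory Matrix InnerProductSpace ComplexConjugate ContinuousMap
open Filter Set Function TopologicalSpace MeasureTheory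
open Summit.Langlands.Langlands.Theses.HeptagonalTower

/-! ## 1. The four stubs -/

/-- **STUB 1 — the real 7-cyclotomic tower is cyclic of odd degree and misses `√5`.**  A totally real
number field `K` admitting a ring embedding into some `ℚ(ζ_{7^{n+1}})` is Galois over `ℚ` with cyclic
Galois group, has odd degree `[K:ℚ] ∣ 3·7ⁿ`, and `5` is not a square in `K`.  (Galois correspondence
inside the cyclic extension `ℚ(ζ_{7^{n+1}})/ℚ`; total reality puts `K` inside the maximal real
subfield of degree `3·7ⁿ`; an odd-degree field has no quadratic subfield.)  Size M, Mathlib-provable.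
[folklore] -/
theorem stub_towerField :
    ∀ (K : Type) [Field K] [NumberField K], NumberField.IsTotallyReal K →
      (∃ n : ℕ, Nonempty (K →+* CyclotomicField ((7 : ℕ+) ^ (n + 1)) ℚ)) →
      IsGalois ℚ K ∧ IsCyclic (K ≃ₐ[ℚ] K) ∧ Odd (Module.finrank ℚ K) ∧ ¬ IsSquare (5 : K) := by
  sorry

/-- **STUB 2 — Legendre-model point control gives `E₁(K) = E₁(ℚ)`.**  If every `K`-point of the
Legendre model `y² = x³ + 41x² + 400x` of `X₀(15)` is torsion and every torsion affine `K`-point is one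
of `(0,0), (−16,0), (−25,0), (20,±180), (−20,±20)` (the crux's hypotheses, verbatim), then every affine
`K`-point of Thorne's model `E₁ : y² + xy + y = x³ + x² − 10x − 10` (15A1) has both coordinates in `ℚ`
(`Thorne2019.PointsRational E₁ K`): transport `(x, y) ↦ (4x − 12, 8y + 4x + 4)` along the proved
isomorphism `Thorne2019.variableChange_E₁ : legendreChange • E₁ = X0FifteenLegendre` (a point of `E₁`
satisfying the equation is nonsingular since `Δ(E₁) = 15⁴ ≠ 0`), read off the list, invert the affine
substitution over `ℚ`.  Size M, Mathlib-provable. [cite: Thorne2019, Prop. 4] -/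
theorem stub_legendreTransport :
    ∀ (K : Type) [Field K] [NumberField K],
      (∀ P : (({ a₁ := 0, a₂ := 41, a₃ := 0, a₄ := 400, a₆ := 0 } : WeierstrassCurve ℚ).baseChange K).toAffine.Point, IsOfFinAddOrder P) →
      (∀ (x y : K) (h : (({ a₁ := 0, a₂ := 41, a₃ := 0, a₄ := 400, a₆ := 0 } : WeierstrassCurve ℚ).baseChange K).toAffine.Nonsingular x y), IsOfFinAddOrder (WeierstrassCurve.Affine.Point.some x y h) → (x = 0 ∧ y = 0) ∨ (x = -16 ∧ y = 0) ∨ (x = -25 ∧ y = 0) ∨ (x = 20 ∧ y = 180) ∨ (x = 20 ∧ y = -180) ∨ (x = -20 ∧ y = 20) ∨ (x = -20 ∧ y = -20)) →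
      Literature.NumberTheory.Automorphic.Thorne2019.PointsRational Literature.NumberTheory.Automorphic.Thorne2019.E₁ K := by
  sorry

/-- **STUB 3 — Yoshikawa 2022, Corollary 3.3 (1) at `F = ℚ`: odd degree slaves `X(s3,b5)` to `X₀(15)`.**
For a number field `K` of odd degree, if every affine `K`-point of `E₁` (15A1 `≅ X₀(15)`) is rational
then so is every affine `K`-point of `E₂ : y² + xy + y = x³ + x² − 5x + 2` (15A3 `≅ X(s3,b5)`): the
degree-2 isogeny `E₂ → E₁` over `ℚ` maps a `K`-point to a rational point, whose fibre is defined over an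
extension of degree `≤ 2`, and `K` has no quadratic subfield.  Dischargeable from the named fact
`Yoshikawa2022_corollary3_3_1` (its `Nonsingular` phrasing is equivalent on elliptic curves) or by the
explicit 2-isogeny.  Size M. [cite: Yoshikawa2022, Cor. 3.3 (1)] -/
theorem stub_oddDegreeDescent :
    ∀ (K : Type) [Field K] [NumberField K], Odd (Module.finrank ℚ K) →
      Literature.NumberTheory.Automorphic.Thorne2019.PointsRational Literature.NumberTheory.Automorphic.Thorne2019.E₁ K →
      Literature.NumberTheory.Automorphic.Thorne2019.PointsRational Literature.NumberTheory.Automorphic.Thorne2019.E₂ K := by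
  sorry

/-- **STUB 4 — Thorne 2019, Lemma 3 (second part), with Proposition 4 (the load-bearing input).**  Let
`K` be a totally real number field with `√5 ∉ K` and `K/ℚ` cyclic.  If `E₁(K) = E₁(ℚ)` and
`E₂(K) = E₂(ℚ)`, then every elliptic curve over `K` (integral model, `Δ ≠ 0`) is modular
(`IsModularEllipticCurve K E`: geometric CM, or a weight-zero cuspidal `π` of `GL₂(𝔸_K)` with
`T_w`-eigenvalue `a_w(E)` at cofinitely many `w` — definitionally the crux's inlined disjunction).
Printed proof: `ρ̄_{E,5}` irreducible ⇒ modular (Thorne 2016, Thm 7.6); else `ρ̄_{E,3}|G_{K(ζ₃)}`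
absolutely irreducible ⇒ modular (Langlands–Tunnell + FLHS 2015); else `E` gives a `K`-point of
`X₀(15)` or `X(s3,b5)`, rational by hypothesis, so `j(E) ∈ ℚ` and `E` is a twist of the base change
along the cyclic `K/ℚ` of a modular curve over `ℚ`.  Verbatim the body of the named fact
`Literature.NumberTheory.Automorphic.Thorne2019_lemma3` (discharged at proof time by that hypothesis).
Size XL from scratch. [cite: Thorne2019, Lemma 3 and Prop. 4] -/
theorem stub_thorneLemma3 :
    ∀ (K : Type) [Field K] [NumberField K], NumberField.IsTotallyReal K → ¬ IsSquare (5 : K) →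
      IsGalois ℚ K → IsCyclic (K ≃ₐ[ℚ] K) →
      Literature.NumberTheory.Automorphic.Thorne2019.PointsRational Literature.NumberTheory.Automorphic.Thorne2019.E₁ K →
      Literature.NumberTheory.Automorphic.Thorne2019.PointsRational Literature.NumberTheory.Automorphic.Thorne2019.E₂ K →
      ∀ E : WeierstrassCurve (NumberField.RingOfIntegers K), E.Δ ≠ 0 →
        Literature.NumberTheory.Automorphic.IsModularEllipticCurve K E := by
  sorry

/-! ## 2. The stub statements as named `Prop`s (literally their types) -/

namespace _Goal

/-- The statement of `stub_towerField`, as a named `Prop` (literally its type). [folklore] -/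
def stub_towerField : Prop :=
  type_of% @Summit.Langlands.Langlands.Cruxes.OddDegreeDoor.Birth.stub_towerField

/-- The statement of `stub_legendreTransport`, as a named `Prop` (literally its type). [folklore] -/
def stub_legendreTransport : Prop :=
  type_of% @Summit.Langlands.Langlands.Cruxes.OddDegreeDoor.Birth.stub_legendreTransport

/-- The statement of `stub_oddDegreeDescent`, as a named `Prop` (literally its type). [folklore] -/
def stub_oddDegreeDescent : Prop :=
  type_of% @Summit.Langlands.Langlands.Cruxes.OddDegreeDoor.Birth.stub_oddDegreeDescent

/-- The statement of `stub_thorneLemma3`, as a named `Prop` (literally its type). [folklore] -/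
def stub_thorneLemma3 : Prop :=
  type_of% @Summit.Langlands.Langlands.Cruxes.OddDegreeDoor.Birth.stub_thorneLemma3

end _Goal

/-- Read-back: stub 4 is, by `Iff.rfl`, the named fact `Thorne2019_lemma3`. [cite: Thorne2019, Lemma 3] -/
example : _Goal.stub_thorneLemma3 ↔ Literature.NumberTheory.Automorphic.Thorne2019_lemma3 :=
  Iff.rfl

/-! ## 3. The composition (kernel-checked, no `sorry`): the crux BY NAME from the four stubs -/

/-- **`OddDegreeDoor` from the four stubs.**  For `K` totally real inside some `ℚ(ζ_{7^{n+1}})`: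
stub 1 gives `K/ℚ` cyclic Galois, `[K:ℚ]` odd, `√5 ∉ K`; stub 2 turns the crux's Legendre-model
hypotheses into `E₁(K) = E₁(ℚ)`; stub 3 (odd degree) gives `E₂(K) = E₂(ℚ)`; stub 4 (Thorne's Lemma 3)
concludes modularity of every `E/K`, which is the crux's conclusion by `unfold`.  Hypotheses are, by
name, the statements of the four stubs; the conclusion is the route decl. [folklore] -/
theorem OddDegreeDoor_of (h₁ : _Goal.stub_towerField) (h₂ : _Goal.stub_legendreTransport)
    (h₃ : _Goal.stub_oddDegreeDescent) (h₄ : _Goal.stub_thorneLemma3) : OddDegreeDoor := by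
  have H₁ : type_of% @stub_towerField := h₁
  have H₂ : type_of% @stub_legendreTransport := h₂
  have H₃ : type_of% @stub_oddDegreeDescent := h₃
  have H₄ : type_of% @stub_thorneLemma3 := h₄
  intro K _ _ hK hemb htors hlist E hE
  obtain ⟨hgal, hcyc, hodd, h5⟩ := H₁ K hK hemb
  have hE₁ := H₂ K htors hlist
  have hE₂ := H₃ K hodd hE₁
  exact H₄ K hK h5 hgal hcyc hE₁ hE₂ E hE

/-- The skeleton instantiated on the (sorried) stubs: `OddDegreeDoor` modulo exactly the four stubs.
[folklore] -/
theorem OddDegreeDoor_skeleton : OddDegreeDoor :=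
  OddDegreeDoor_of stub_towerField stub_legendreTransport stub_oddDegreeDescent stub_thorneLemma3

/-- **The same composition as PURE LOGIC, hypothetical form** `<stub₁-sig> → … → <stub₄-sig> →
OddDegreeDoor`, signatures spelled out (sorry-free, axiom-clean). [folklore] -/
example :
    (∀ (K : Type) [Field K] [NumberField K], NumberField.IsTotallyReal K →
      (∃ n : ℕ, Nonempty (K →+* CyclotomicField ((7 : ℕ+) ^ (n + 1)) ℚ)) →
      IsGalois ℚ K ∧ IsCyclic (K ≃ₐ[ℚ] K) ∧ Odd (Module.finrank ℚ K) ∧ ¬ IsSquare (5 : K)) →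
    (∀ (K : Type) [Field K] [NumberField K],
      (∀ P : (({ a₁ := 0, a₂ := 41, a₃ := 0, a₄ := 400, a₆ := 0 } : WeierstrassCurve ℚ).baseChange K).toAffine.Point, IsOfFinAddOrder P) →
      (∀ (x y : K) (h : (({ a₁ := 0, a₂ := 41, a₃ := 0, a₄ := 400, a₆ := 0 } : WeierstrassCurve ℚ).baseChange K).toAffine.Nonsingular x y), IsOfFinAddOrder (WeierstrassCurve.Affine.Point.some x y h) → (x = 0 ∧ y = 0) ∨ (x = -16 ∧ y = 0) ∨ (x = -25 ∧ y = 0) ∨ (x = 20 ∧ y = 180) ∨ (x = 20 ∧ y = -180) ∨ (x = -20 ∧ y = 20) ∨ (x = -20 ∧ y = -20)) →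
      Literature.NumberTheory.Automorphic.Thorne2019.PointsRational Literature.NumberTheory.Automorphic.Thorne2019.E₁ K) →
    (∀ (K : Type) [Field K] [NumberField K], Odd (Module.finrank ℚ K) →
      Literature.NumberTheory.Automorphic.Thorne2019.PointsRational Literature.NumberTheory.Automorphic.Thorne2019.E₁ K →
      Literature.NumberTheory.Automorphic.Thorne2019.PointsRational Literature.NumberTheory.Automorphic.Thorne2019.E₂ K) →
    (∀ (K : Type) [Field K] [NumberField K], NumberField.IsTotallyReal K → ¬ IsSquare (5 : K) →
      IsGalois ℚ K → IsCyclic (K ≃ₐ[ℚ] K) →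
      Literature.NumberTheory.Automorphic.Thorne2019.PointsRational Literature.NumberTheory.Automorphic.Thorne2019.E₁ K →
      Literature.NumberTheory.Automorphic.Thorne2019.PointsRational Literature.NumberTheory.Automorphic.Thorne2019.E₂ K →
      ∀ E : WeierstrassCurve (NumberField.RingOfIntegers K), E.Δ ≠ 0 →
        Literature.NumberTheory.Automorphic.IsModularEllipticCurve K E) →
    OddDegreeDoor := by
  intro H₁ H₂ H₃ H₄ K _ _ hK hemb htors hlist E hE
  obtain ⟨hgal, hcyc, hodd, h5⟩ := H₁ K hK hemb
  exact H₄ K hK h5 hgal hcyc (H₂ K htors hlist) (H₃ K hodd (H₂ K htors hlist)) E hE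

/-- Sanity (read-back): the crux's conclusion for `E/K` is, definitionally, `IsModularEllipticCurve K E`
— the route decl unfolds to Thorne's hypotheses-to-modularity shape used to cut the stubs. [folklore] -/
example : OddDegreeDoor ↔
    (∀ (K : Type) [Field K] [NumberField K], NumberField.IsTotallyReal K →
      (∃ n : ℕ, Nonempty (K →+* CyclotomicField ((7 : ℕ+) ^ (n + 1)) ℚ)) →
      (∀ P : (({ a₁ := 0, a₂ := 41, a₃ := 0, a₄ := 400, a₆ := 0 } : WeierstrassCurve ℚ).baseChange K).toAffine.Point, IsOfFinAddOrder P) →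
      (∀ (x y : K) (h : (({ a₁ := 0, a₂ := 41, a₃ := 0, a₄ := 400, a₆ := 0 } : WeierstrassCurve ℚ).baseChange K).toAffine.Nonsingular x y), IsOfFinAddOrder (WeierstrassCurve.Affine.Point.some x y h) → (x = 0 ∧ y = 0) ∨ (x = -16 ∧ y = 0) ∨ (x = -25 ∧ y = 0) ∨ (x = 20 ∧ y = 180) ∨ (x = 20 ∧ y = -180) ∨ (x = -20 ∧ y = 20) ∨ (x = -20 ∧ y = -20)) →
      ∀ E : WeierstrassCurve (NumberField.RingOfIntegers K), E.Δ ≠ 0 →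
        Literature.NumberTheory.Automorphic.IsModularEllipticCurve K E) :=
  Iff.rfl

end Summit.Langlands.Langlands.Cruxes.OddDegreeDoor.Birth

end
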